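import Literature.MathematicalPhysics.QuantumFieldTheory.Balaban1983to89.T4AxialGaugeSmallField
import Literature.MathematicalPhysics.QuantumFieldTheory.Balaban1983to89.T4Continuum
import HarnessLib

/-!
# `UnitScaleGibbsBlockPlaquetteSmallFieldBoxBridge` — FROM THE BOX OF CONSTRUCTION C3 TO THE BASE HULL OF THE CONE: plaquette-small on a non-wrapping
# box ⟹ the axial-gauge representative is plaquette-small (`θ`) AND bond-small (`(d−1)·n·θ`) on every walk hull inside the box
# (the level-0 input of ✓`UnitScaleGibbsBlockPlaquetteSmallFieldCone.smallFieldCone`; S_lin ∕ `stub_linTest` of LINE 28 «gross-sd-transfer»; crux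
# `UnitScaleTilt.HistoryTailL`, stmt-QuantumFields-19936)

Cell `ym3-torus` (YM ladder rung R3 = continuum SU(2) Yang–Mills on T³ — a RUNG, NOT the Clay problem: not d = 4, not infinite volume, not a
mass gap), width seat `ym-ust-19936-w2` (gen 14).  LINE 28 skeleton v1 (`stub_linTest`, ideator `ym-r3-idea-2` g16) speaks the BOX currency of
✓`T4AxialGaugeSmallField`: an integer box `[lo, hi]` with `hi ≤ lo + n`, `n < sitesPerDir` (non-wrapping), its torus plaquettes `boxPlaqs lo hi`, the
small-field event `PlaqSmallOn (boxPlaqs lo hi) θ U`, and the representative `V = U^{axialGauge U lo hi}`; the local linearisation chain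
(✓`…SmallFieldCone`, ✓`…TransportFreeLinearisationLocal`) speaks the WALK-HULL currency of ✓`HistoryTailStokesLocal`: plaquettes ∕ bonds at
`walkEnd c v`, `|v| ≤ R`.  THIS FILE is the dictionary between the two at the base of the cone:

* §1 `walkEnd_castSite` — a walk from the image `castSite z` of an integer point ends at `castSite (z + netDisp v)`; with
  `|netDisp v κ| ≤ |v|` (= ✓`HistoryTailWalkLocality.abs_netDisp_le_length`, re-derived here so that this file does not sit on a route cone) the hull
  of radius `R` around `castSite z₀` is the image of the `ℓ∞`-ball of radius `R`;
* §2 ★★ `hull_small_of_plaqSmallOn_box` — if `PlaqSmallOn (boxPlaqs lo hi) θ U`, `0 ≤ θ`, `hi ≤ lo + n`, `n < sitesPerDir j`, and the integer point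
  `z₀` sits in the box with margins `lo + R ≤ z₀`, `z₀ + R + 2 ≤ hi`, then on the hull of radius `R` around `castSite z₀` the representative
  `V = U^{axialGauge U lo hi}` has every plaquette within `θ` of `1` (gauge invariance of `dist₁ ∘ plaqHol`) and every bond within `(d−1)·n·θ` of `1`
  (✓`T4AxialGaugeSmallField.dist1_gaugeAct_axialGauge_le_uniform`, the torus non-abelian Poincaré lemma, BY NAME);
* §3 ★ `exists_box_around` — around every site `c₀` and radius `R` with `2R + 2 < sitesPerDir j` there IS such a box: `c₀ = castSite z₀`,
  `lo = z₀ − R`, `hi = z₀ + R + 2`, `n = 2R + 2` (the canonical choice the `stub_linTest` pen can make; side `n ≍ L^{j}` when `R ≍ L^{j}`).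

HONEST FRAMING.  Bookkeeping (`--supports stmt-QuantumFields-19936`); 0 `def`, 0 `sorry`; proves no stub, crux, rung or summit statement;
`stub_linTest`, «ShallowFluxSecondMomentL», (Q), K1, `MeanDeviationL`, `HistoryTailL` are NOT proved; the Yang–Mills mass gap is NOT proved.

References: [Balaban1985UV3] T. Bałaban, CMP 102 (1985) 255–275, (38)–(40) p. 266 (small-field regions and axial gauges on cubes);
[Balaban1987RG1] T. Bałaban, CMP 109 (1987) 249–301, (0.1)–(0.3) pp. 251–252.
-/

noncomputable section

set_option autoImplicit false

namespace Summit.QuantumFields.YangMills.Theorems.UnitScaleGibbsBlockPlaquetteSmallFieldBoxBridge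

open Literature.MathematicalPhysics.QuantumFieldTheory.Balaban1983to89
open Literature.MathematicalPhysics.QuantumFieldTheory.Balaban1983to89.T4AxialGaugeSmallField (castSite castSite_apply boxPlaqs axialGauge
  dist1_gaugeAct_axialGauge_le_uniform)
open Literature.MathematicalPhysics.QuantumFieldTheory.Balaban1983to89.B7Prop1Explicit (e e_apply)
open T4Continuum (walkEnd walkEnd_apply netDisp netDisp_cons Letter)

variable {P : Params} {j : ℕ}

/-! ## §1 Walks from the image of an integer point -/

/-- A walk from `castSite z` ends at `castSite (z + netDisp v)`. [folklore] -/
theorem walkEnd_castSite (z : Fin P.d → ℤ) (v : List (Letter P.d)) :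
    walkEnd (castSite z : Site P j) v = castSite (fun κ => z κ + netDisp v κ) := by
  funext κ
  rw [walkEnd_apply, castSite_apply, castSite_apply, Int.cast_add]

/-- `|netDisp v ν| ≤ |v|` (= ✓`HistoryTailWalkLocality.abs_netDisp_le_length`, re-derived to keep this file off the route cone). [folklore] -/
private theorem abs_netDisp_le_length {d : ℕ} (ν : Fin d) : ∀ v : List (Letter d), |netDisp v ν| ≤ v.length
  | [] => by simp [netDisp]
  | l :: v => by
    rw [netDisp_cons, List.length_cons]
    have ih := abs_netDisp_le_length ν v
    have hl : |(if l.1 = ν then (if l.2 then (1 : ℤ) else -1) else 0)| ≤ 1 := by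
      split_ifs <;> simp
    push_cast
    exact (abs_add_le _ _).trans (by linarith)

/-- The integer end point of a walk of length `≤ R` from `z₀` lies in the `ℓ∞`-ball of radius `R`: with margins `lo + R ≤ z₀`, `z₀ + R + 2 ≤ hi` it
satisfies `lo ≤ x` and `x κ + 2 ≤ hi κ`. [folklore] -/
theorem endpoint_mem_box {lo hi z₀ : Fin P.d → ℤ} {R : ℕ} (hlo : ∀ κ, lo κ + R ≤ z₀ κ) (hhi : ∀ κ, z₀ κ + R + 2 ≤ hi κ)
    (v : List (Letter P.d)) (hv : v.length ≤ R) :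
    lo ≤ (fun κ => z₀ κ + netDisp v κ) ∧ ∀ κ, z₀ κ + netDisp v κ + 2 ≤ hi κ := by
  have hd : ∀ κ, |netDisp v κ| ≤ (R : ℤ) := fun κ => (abs_netDisp_le_length κ v).trans (by exact_mod_cast hv)
  refine ⟨fun κ => ?_, fun κ => ?_⟩
  · have h := hd κ
    have h1 := hlo κ
    rw [abs_le] at h
    show lo κ ≤ z₀ κ + netDisp v κ
    linarith
  · have h := hd κ
    have h1 := hhi κ
    rw [abs_le] at h
    linarith

section Main

variable {G : Type*} [GaugeGroup G]

/-- The far corner of a plaquette does not depend on the order of the two steps. [folklore] -/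
private theorem shift_shift_comm (x : Site P j) (μ ν : Fin P.d) : (x.shift μ).shift ν = (x.shift ν).shift μ := by
  funext κ
  by_cases h1 : κ = ν
  · subst h1
    by_cases h2 : κ = μ
    · subst h2; rfl
    · simp [Site.shift, Function.update_of_ne h2]
  · by_cases h2 : κ = μ
    · subst h2
      simp [Site.shift, Function.update_of_ne h1]
    · simp [Site.shift, Function.update_of_ne h1, Function.update_of_ne h2]

/-- Gauge invariance of `dist₁(U(∂p))` (`U^u(∂p) = u(p₋)·U(∂p)·u(p₋)⁻¹`; twin of ✓`B15Prop1Carrier.dist1_plaqHol_gaugeAct`, re-derived to keep the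
import closure small). [cite: Balaban1985Averaging, (12) p.19] -/
private theorem dist1_plaqHol_gaugeAct (u : GaugeTransf P j G) (U : GaugeField P j G) (p : Plaq P j) :
    dist1 (GaugeField.plaqHol (GaugeField.gaugeAct u U) p) = dist1 (GaugeField.plaqHol U p) := by
  have e1 : GaugeField.plaqHol (GaugeField.gaugeAct u U) p = u p.src * GaugeField.plaqHol U p * (u p.src)⁻¹ := by
    simp only [GaugeField.plaqHol, GaugeField.gaugeAct, PBond.tgt, shift_shift_comm p.src p.ν p.μ, mul_inv_rev, inv_inv]
    group
  rw [e1, GaugeGroup.dist1_conj]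

/-! ## §2 The bridge: box smallness ⟹ hull smallness of the axial-gauge representative -/

/-- ★★ **BOX ⟹ HULL.**  Let `[lo, hi]` be a non-wrapping integer box (`hi ≤ lo + n`, `n < sitesPerDir j`), `PlaqSmallOn (boxPlaqs lo hi) θ U` with
`0 ≤ θ`, and `z₀` an integer point with margins `lo + R ≤ z₀`, `z₀ + R + 2 ≤ hi` (coordinatewise).  Then the axial-gauge representative
`V = U^{axialGauge U lo hi}` satisfies, on the walk hull of radius `R` around `castSite z₀`:
(i) every plaquette `⟨walkEnd (castSite z₀) v; a < b⟩`, `|v| ≤ R`, is within `θ` of `1` (plaquette variables are gauge covariant, and the plaquette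
lies in `boxPlaqs lo hi`); (ii) every bond `⟨walkEnd (castSite z₀) v, κ⟩`, `|v| ≤ R`, is within `(d−1)·n·θ` of `1` (the torus non-abelian Poincaré
lemma ✓`dist1_gaugeAct_axialGauge_le_uniform`).  These are the level-0 inputs `hplaq0 ∕ hbond0` of ✓`UnitScaleGibbsBlockPlaquetteSmallFieldCone.smallFieldCone`
with `c 0 = castSite z₀`, `R 0 = R`, `a 0 = θ`, `η 0 = (d−1)·n·θ`. [cite: Balaban1985UV3, (38)-(40) p.266] -/
theorem hull_small_of_plaqSmallOn_box (U : GaugeField P j G) {lo hi : Fin P.d → ℤ} {n : ℕ} (hn : ∀ κ, hi κ ≤ lo κ + n)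
    (hnN : n < P.sitesPerDir j) {θ : ℝ} (hθ : 0 ≤ θ) (hU : PlaqSmallOn (boxPlaqs lo hi) θ U) (z₀ : Fin P.d → ℤ) {R : ℕ}
    (hlo : ∀ κ, lo κ + R ≤ z₀ κ) (hhi : ∀ κ, z₀ κ + R + 2 ≤ hi κ) :
    (∀ v : List (Letter P.d), v.length ≤ R → ∀ (a b : Fin P.d) (h : a < b),
        dist1 (GaugeField.plaqHol (GaugeField.gaugeAct (axialGauge U lo hi) U) ⟨walkEnd (castSite z₀) v, a, b, h⟩) ≤ θ) ∧
      (∀ v : List (Letter P.d), v.length ≤ R → ∀ κ : Fin P.d,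
        dist1 (GaugeField.gaugeAct (axialGauge U lo hi) U ⟨walkEnd (castSite z₀) v, κ⟩) ≤ ((P.d - 1 : ℕ) : ℝ) * n * θ) := by
  refine ⟨fun v hv a b h => ?_, fun v hv κ => ?_⟩
  · obtain ⟨hx, hx2⟩ := endpoint_mem_box hlo hhi v hv
    rw [dist1_plaqHol_gaugeAct, walkEnd_castSite]
    refine le_of_lt (hU _ ⟨fun κ => z₀ κ + netDisp v κ, hx, fun κ => ?_, rfl⟩)
    simp only [Pi.add_apply, e_apply]
    have h2 := hx2 κ
    split_ifs <;> linarith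
  · obtain ⟨hx, hx2⟩ := endpoint_mem_box hlo hhi v hv
    rw [walkEnd_castSite]
    refine dist1_gaugeAct_axialGauge_le_uniform U subset_rfl hU hθ hn hnN hx fun κ' => ?_
    simp only [Pi.add_apply, e_apply]
    have h2 := hx2 κ'
    split_ifs <;> linarith

/-! ## §3 The canonical box around a site -/

/-- ★ **A BOX AROUND EVERY HULL**: for every site `c₀` of `T^{(j)}` and radius `R` with `2R + 2 < sitesPerDir j` there are an integer point `z₀` with
`c₀ = castSite z₀` and the box `lo = z₀ − R`, `hi = z₀ + R + 2` of `n = 2R + 2` steps per direction (non-wrapping), with the margins of §2.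
[cite: Balaban1987RG1, (0.1) p.251] -/
theorem exists_box_around (c₀ : Site P j) (R : ℕ) :
    ∃ (z₀ lo hi : Fin P.d → ℤ), c₀ = castSite z₀ ∧ (∀ κ, lo κ ≤ hi κ ∧ hi κ ≤ lo κ + (2 * R + 2 : ℕ)) ∧
      (∀ κ, lo κ + R ≤ z₀ κ) ∧ (∀ κ, z₀ κ + R + 2 ≤ hi κ) := by
  have hR : (0 : ℤ) ≤ (R : ℤ) := Int.natCast_nonneg R
  refine ⟨fun κ => ((c₀ κ).val : ℤ), fun κ => ((c₀ κ).val : ℤ) - R, fun κ => ((c₀ κ).val : ℤ) + R + 2, ?_, fun κ => ⟨?_, ?_⟩,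
    fun κ => ?_, fun κ => ?_⟩
  · funext κ
    rw [castSite_apply, Int.cast_natCast, ZMod.natCast_zmod_val]
  · show ((c₀ κ).val : ℤ) - R ≤ ((c₀ κ).val : ℤ) + R + 2
    linarith
  · show ((c₀ κ).val : ℤ) + R + 2 ≤ ((c₀ κ).val : ℤ) - R + ((2 * R + 2 : ℕ) : ℤ)
    push_cast
    linarith
  · show ((c₀ κ).val : ℤ) - R + R ≤ ((c₀ κ).val : ℤ)
    linarith
  · exact le_rfl

end Main

end Summit.QuantumFields.YangMills.Theorems.UnitScaleGibbsBlockPlaquetteSmallFieldBoxBridge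

end
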